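import Summits.NavierStokesRegularity.NavierStokesRegularity.Theorems.ScenarioCensusRowF1ColumnarTransfer
import HarnessLib

/-!
# LINE «columnar-top» port, part 4/4: the rows are EXCLUDED (`rowF1va_holds` … `rowF1sd_holds`), the floor `genuinelyThreeDTop_holds`, displays,
# `columnarCollapse_iff_rowF1`; census KEYS `Row_F1co` / `Row_F1sd` / `Row_F1va` / `Row_F1vs` / `Row_F1sv` + `_excluded`

Re-homed for the scenario census (typer seat ns-census-typer-1 g7; the cells F1sd ⊆ F1co and F1sv ⊆ F1vs ⊆ F1va are MEMBERS OF RECORD «DECIDED IN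
KERNEL IN FILES» of row F1 since census v1.68 (critic idea-crit-3 PASS 19:19:37Z; ref ns-census-ref g8 PRE-CHECK ✓ §13.14 [2/6]; lit §21.20); this port makes
them TREE-decided): VERBATIM PORT of ns-idea-3 LINE 15 «columnar-top», `pub/ideators/ns-idea-3/lines/columnar-top/line-columnar-top.lean` sha16
c9a7d5b1dc6ba717 (818 l., lean check rc 0, 0 sorry), split for the 400-line rule into `ScenarioCensusRowF1Columnar` (§1) → `…ColumnarZoom` (§2) →
`…ColumnarTransfer` (§3) → `…ColumnarTop` (§4 + census KEYS).  Lean text VERBATIM in namespace `…Theorems.ScenarioCensus.ColumnarTop` (the line's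
`…Cruxes.ScenarioCensusRowF1.ColumnarTopLine` re-homed); port edits: `@[conjecture]` on the residual `ColumnarCollapse` (≡ `ScenarioCensus.Row_F1`, OPEN),
three one-line docstrings added.

No census VALUE is moved here (row F1 stays OPEN-WITH-LINE; the members become TREE-decided by name); NS regularity is NOT proved; `Row_F1` is
untouched (zero movement, `columnarCollapse_iff_rowF1`); no summit statement is proved by this file.
-/

-- the summit and its single problem share the name `NavierStokesRegularity` (D-0017 nested layout)
set_option linter.dupNamespace false

noncomputable section

open MeasureTheory Set Function Filter TopologicalSpace Metric
open scoped Topology NNReal ENNReal InnerProductSpace RealInnerProductSpace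

namespace Summit.NavierStokesRegularity.NavierStokesRegularity.Theorems.ScenarioCensus.ColumnarTop

open Literature.Analysis Literature.Analysis.FluidPDE
open Summit.NavierStokesRegularity.NavierStokesRegularity.Theorems

/-! ## §4 The rows are EXCLUDED; the floor; displays; the residual is exactly `Row_F1` -/

/-- **Criterion row F1va is EXCLUDED** (in kernel): Type I + a vorticity axis on the top ⇒ extension. -/
theorem rowF1va_holds : Row_F1va := by
  intro ν T hν hT u p hsol hLH hdec hTI hva
  obtain ⟨Λ, hΛ, e, he, hax⟩ := hva
  apply hasSmoothExtensionPast_of_forall_exists_parabolicCylinder hν hT hsol hLH hdec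
  intro x₀
  by_contra hno
  have hsing : ∀ r : ℝ, 0 < r →
      eLpNorm (uncurry u) ∞ (volume.restrict (parabolicCylinder r ((T : ℝ), x₀))) = ∞ := by
    intro r hr
    by_contra h
    exact hno ⟨r, hr, lt_top_iff_ne_top.2 h⟩
  obtain ⟨C, α, β, R, c, W, hα, hβ, hR, hcpos, hclim, hW, hpt, hgrad, t, ht, y, hne⟩ :=
    exists_singularZoom_package hν hT hsol hLH hdec hTI x₀ hsing
  exact hne (eq_zero_of_vorticityAxis hα hβ hR hcpos hclim hW hpt hgrad hΛ he hax t ht y)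

/-- **Criterion row F1co is EXCLUDED** (in kernel): Type I + a columnar top ⇒ extension. -/
theorem rowF1co_holds : Row_F1co := by
  intro ν T hν hT u p hsol hLH hdec hTI hco
  obtain ⟨Λ, hΛ, e, he, hsl⟩ := hco
  apply hasSmoothExtensionPast_of_forall_exists_parabolicCylinder hν hT hsol hLH hdec
  intro x₀
  by_contra hno
  have hsing : ∀ r : ℝ, 0 < r →
      eLpNorm (uncurry u) ∞ (volume.restrict (parabolicCylinder r ((T : ℝ), x₀))) = ∞ := by
    intro r hr
    by_contra h
    exact hno ⟨r, hr, lt_top_iff_ne_top.2 h⟩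
  obtain ⟨C, α, β, R, c, W, hα, hβ, hR, hcpos, hclim, hW, hpt, hgrad, t, ht, y, hne⟩ :=
    exists_singularZoom_package hν hT hsol hLH hdec hTI x₀ hsing
  exact hne (eq_zero_of_slackDirection hα hβ hR hcpos hclim hW hpt hgrad hΛ he hsl t ht y)

/-- **Criterion row F1vs is EXCLUDED** (in kernel; corollary of `rowF1va_holds`). -/
theorem rowF1vs_holds : Row_F1vs := rowF1vs_of_rowF1va rowF1va_holds

/-- **Criterion row F1sv is EXCLUDED** (in kernel; corollary of `rowF1vs_holds`). -/
theorem rowF1sv_holds : Row_F1sv := rowF1sv_of_rowF1vs rowF1vs_holds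

/-- **Criterion row F1sd is EXCLUDED** (in kernel; corollary of `rowF1co_holds`). -/
theorem rowF1sd_holds : Row_F1sd := rowF1sd_of_rowF1co rowF1co_holds

/-- **GENUINELY 3D TOP** (structural theorem, in kernel). -/
theorem genuinelyThreeDTop_holds : GenuinelyThreeDTop :=
  fun ν T hν hT u p hmax hLH hdec hTI =>
    ⟨fun h => hmax.2 (rowF1co_holds ν T hν hT u p hmax.1 hLH hdec hTI h),
      fun h => hmax.2 (rowF1va_holds ν T hν hT u p hmax.1 hLH hdec hTI h)⟩

/-- No Type-I Clay blow-up has slack vorticity on its top. -/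
theorem not_hasSlackVorticityTop_of_typeI : ∀ (ν T : ℝ), 0 < ν → 0 < T →
    ∀ (u : ℝ → E3 → E3) (p : ℝ → E3 → ℝ),
    IsMaximalSmoothSolution ν 0 u p T → IsLerayHopfOn T ν 0 (u 0) u →
    HasRapidSpatialDecay (u 0) → IsTypeIBlowup u T → ¬ HasSlackVorticityTop T u :=
  fun ν T hν hT u p hmax hLH hdec hTI h =>
    (genuinelyThreeDTop_holds ν T hν hT u p hmax hLH hdec hTI).2 h.hasVorticityAxisTop

/-- No Type-I Clay blow-up has a global slack direction. -/
theorem not_hasSlackDirection_of_typeI : ∀ (ν T : ℝ), 0 < ν → 0 < T →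
    ∀ (u : ℝ → E3 → E3) (p : ℝ → E3 → ℝ),
    IsMaximalSmoothSolution ν 0 u p T → IsLerayHopfOn T ν 0 (u 0) u →
    HasRapidSpatialDecay (u 0) → IsTypeIBlowup u T → ¬ HasSlackDirection T u :=
  fun ν T hν hT u p hmax hLH hdec hTI h =>
    (genuinelyThreeDTop_holds ν T hν hT u p hmax hLH hdec hTI).1 h.hasColumnarTop

/-- No Type-I Clay blow-up has global sub-Type-I vorticity. -/
theorem not_hasSlackVorticity_of_typeI : ∀ (ν T : ℝ), 0 < ν → 0 < T →
    ∀ (u : ℝ → E3 → E3) (p : ℝ → E3 → ℝ),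
    IsMaximalSmoothSolution ν 0 u p T → IsLerayHopfOn T ν 0 (u 0) u →
    HasRapidSpatialDecay (u 0) → IsTypeIBlowup u T → ¬ HasSlackVorticity T u :=
  fun ν T hν hT u p hmax hLH hdec hTI h =>
    not_hasSlackVorticityTop_of_typeI ν T hν hT u p hmax hLH hdec hTI h.hasSlackVorticityTop

/-- **FULL-RANK TOP, unfolded** (display form, constant levels): in the maximal Type-I Clay frame, for EVERY
unit direction `e` and EVERY level `Λ` there is an `ε > 0` such that for every `t₁ < T` some time
`t ∈ (t₁, T)` has a `Λ`-fast point where `(T − t) ‖∂_e u(t, x)‖ > ε` — the top shears at the Type-I rate in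
every direction, arbitrarily close to `T`. -/
theorem fullRankTop_unfolded : ∀ (ν T : ℝ), 0 < ν → 0 < T →
    ∀ (u : ℝ → E3 → E3) (p : ℝ → E3 → ℝ),
    IsMaximalSmoothSolution ν 0 u p T → IsLerayHopfOn T ν 0 (u 0) u →
    HasRapidSpatialDecay (u 0) → IsTypeIBlowup u T →
    ∀ (e : E3), ‖e‖ = 1 → ∀ Λ : ℝ, ∃ ε : ℝ, 0 < ε ∧ ∀ t₁ : ℝ, t₁ < T →
      ∃ t ∈ Ioo t₁ T, ∃ x : E3, Λ < ‖u t x‖ ∧ ε < (T - t) * ‖fderiv ℝ (u t) x e‖ := by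
  intro ν T hν hT u p hmax hLH hdec hTI e he Λ
  by_contra hno
  push Not at hno
  refine (genuinelyThreeDTop_holds ν T hν hT u p hmax hLH hdec hTI).1
    ⟨fun _ => Λ, isSubcriticalLevel_const T Λ, e, he, fun ε hε => ?_⟩
  obtain ⟨t₁, ht₁, h⟩ := hno ε hε
  exact eventually_of_mem (Ioo_mem_nhdsLT ht₁) fun t ht x hx => h t ht x hx

/-- **NO VORTICITY AXIS, unfolded** (display form, constant levels): for EVERY unit `e` and EVERY level `Λ`
there is an `ε > 0` such that arbitrarily close to `T` some `Λ`-fast point has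
`(T − t) ‖ω − ⟪ω, e⟫ e‖ > ε` — the vorticity of the top refuses every fixed axis at the Type-I rate. -/
theorem noVorticityAxis_unfolded : ∀ (ν T : ℝ), 0 < ν → 0 < T →
    ∀ (u : ℝ → E3 → E3) (p : ℝ → E3 → ℝ),
    IsMaximalSmoothSolution ν 0 u p T → IsLerayHopfOn T ν 0 (u 0) u →
    HasRapidSpatialDecay (u 0) → IsTypeIBlowup u T →
    ∀ (e : E3), ‖e‖ = 1 → ∀ Λ : ℝ, ∃ ε : ℝ, 0 < ε ∧ ∀ t₁ : ℝ, t₁ < T →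
      ∃ t ∈ Ioo t₁ T, ∃ x : E3, Λ < ‖u t x‖ ∧
        ε < (T - t) * ‖curl (u t) x - ⟪curl (u t) x, e⟫_ℝ • e‖ := by
  intro ν T hν hT u p hmax hLH hdec hTI e he Λ
  by_contra hno
  push Not at hno
  refine (genuinelyThreeDTop_holds ν T hν hT u p hmax hLH hdec hTI).2
    ⟨fun _ => Λ, isSubcriticalLevel_const T Λ, e, he, fun ε hε => ?_⟩
  obtain ⟨t₁, ht₁, h⟩ := hno ε hε
  exact eventually_of_mem (Ioo_mem_nhdsLT ht₁) fun t ht x hx => h t ht x hx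

/-- **TYPE-I VORTICITY ON THE TOP, unfolded** (display form, constant levels): for EVERY level `Λ` there is
an `ε > 0` such that arbitrarily close to `T` some `Λ`-fast point carries vorticity `(T − t) ‖ω(t, x)‖ > ε`
— a Type-I blow-up of the velocity is a Type-I blow-up of the vorticity ON THE FAST SET. -/
theorem typeIVorticityOnTop_unfolded : ∀ (ν T : ℝ), 0 < ν → 0 < T →
    ∀ (u : ℝ → E3 → E3) (p : ℝ → E3 → ℝ),
    IsMaximalSmoothSolution ν 0 u p T → IsLerayHopfOn T ν 0 (u 0) u →
    HasRapidSpatialDecay (u 0) → IsTypeIBlowup u T →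
    ∀ Λ : ℝ, ∃ ε : ℝ, 0 < ε ∧ ∀ t₁ : ℝ, t₁ < T →
      ∃ t ∈ Ioo t₁ T, ∃ x : E3, Λ < ‖u t x‖ ∧ ε < (T - t) * ‖curl (u t) x‖ := by
  intro ν T hν hT u p hmax hLH hdec hTI Λ
  by_contra hno
  push Not at hno
  refine not_hasSlackVorticityTop_of_typeI ν T hν hT u p hmax hLH hdec hTI
    ⟨fun _ => Λ, isSubcriticalLevel_const T Λ, fun ε hε => ?_⟩
  obtain ⟨t₁, ht₁, h⟩ := hno ε hε
  exact eventually_of_mem (Ioo_mem_nhdsLT ht₁) fun t ht x hx => h t ht x hx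

/-- **Row F1 ≡ ColumnarCollapse** (exact reformulation, in kernel). -/
theorem columnarCollapse_iff_rowF1 : ColumnarCollapse ↔ ScenarioCensus.Row_F1 :=
  ⟨fun h => rowF1_of rowF1sd_holds h, columnarCollapse_of_rowF1⟩

/-- **Composition concluding the target BY NAME**: `ColumnarCollapse → Row_F1`. -/
theorem rowF1_of_columnarCollapse : ColumnarCollapse → ScenarioCensus.Row_F1 :=
  columnarCollapse_iff_rowF1.1

end Summit.NavierStokesRegularity.NavierStokesRegularity.Theorems.ScenarioCensus.ColumnarTop

namespace Summit.NavierStokesRegularity.NavierStokesRegularity.Theorems.ScenarioCensus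

/-! ## Census KEYS (ns `…Theorems.ScenarioCensus`): the SLACK / COLUMNAR family of row F1 — TREE-decided members -/

/-- **Cell F1co** (row F1 frame VERBATIM + a COLUMNAR top at a subcritical moving level ⇒ smooth extension past `T`): `:= ColumnarTop.Row_F1co`. DECIDED. -/
def Row_F1co : Prop := ColumnarTop.Row_F1co
/-- F1co is EXCLUDED (decided in the tree): `ColumnarTop.rowF1co_holds`. -/
theorem row_F1co_excluded : Row_F1co := ColumnarTop.rowF1co_holds

/-- **Cell F1sd** (⊆ F1co): `:= ColumnarTop.Row_F1sd`. DECIDED. -/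
def Row_F1sd : Prop := ColumnarTop.Row_F1sd
/-- F1sd is EXCLUDED (decided in the tree): `ColumnarTop.rowF1sd_holds`. -/
theorem row_F1sd_excluded : Row_F1sd := ColumnarTop.rowF1sd_holds

/-- **Cell F1va**: `:= ColumnarTop.Row_F1va`. DECIDED. -/
def Row_F1va : Prop := ColumnarTop.Row_F1va
/-- F1va is EXCLUDED (decided in the tree): `ColumnarTop.rowF1va_holds`. -/
theorem row_F1va_excluded : Row_F1va := ColumnarTop.rowF1va_holds

/-- **Cell F1vs** (⊆ F1va): `:= ColumnarTop.Row_F1vs`. DECIDED. -/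
def Row_F1vs : Prop := ColumnarTop.Row_F1vs
/-- F1vs is EXCLUDED (decided in the tree): `ColumnarTop.rowF1vs_holds`. -/
theorem row_F1vs_excluded : Row_F1vs := ColumnarTop.rowF1vs_holds

/-- **Cell F1sv** (⊆ F1vs): `:= ColumnarTop.Row_F1sv`. DECIDED. -/
def Row_F1sv : Prop := ColumnarTop.Row_F1sv
/-- F1sv is EXCLUDED (decided in the tree): `ColumnarTop.rowF1sv_holds`. -/
theorem row_F1sv_excluded : Row_F1sv := ColumnarTop.rowF1sv_holds

/-- **Floor GENUINELY-3D TOP** at the level of the census keys: `ColumnarTop.genuinelyThreeDTop_holds`. -/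
theorem row_F1_genuinelyThreeDTop : ColumnarTop.GenuinelyThreeDTop := ColumnarTop.genuinelyThreeDTop_holds

end Summit.NavierStokesRegularity.NavierStokesRegularity.Theorems.ScenarioCensus

end
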